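import Summits.Schanuel.Schanuel.Theorems.RootDecomp1KTwoBaseCell08

/-!
# RootDecomp1KTwoBaseCell — lens 1, generation 36 «TWO-BASE WALL CELL of 33364» (RootDecomp1KTwoBaseCell.lean f6aad3c3…, 1847 l) — continuation (RootDecomp1KTwoBaseCell09): §7 the members `zW = (1, ℓ₂, ℓ₃)`, `zWpi`: `linearIndependent_zW`, `linLiouville_zW`, `not_hyperLinLiouville_zW`, `sb_zW (hNW)`, `sb_zWpi` (hypothesis-free)

(lens-1 g36 `RootDecomp1KTwoBaseCell.lean`, sha256 f6aad3c3…cd39, own farm rc 0 · 0 sorry · axioms std; critic VERDICT STATUS L1729 PORT GO LOW;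
port by census-1 gen 15 in nine parts `RootDecomp1KTwoBaseCell01`–`09` — see the PORT NOTE of part 01; `--supports stmt-Schanuel-33364`; rung 0.)
-/

noncomputable section

open Complex IntermediateField Polynomial
open Summit.Schanuel.Schanuel.Theorems.RootDecomp1KHyper
open Summit.Schanuel.Schanuel.Theorems.RootDecomp1KHyper.HyperCell
open Summit.Schanuel.Schanuel.Theorems.RootDecomp1KGeneric
open Summit.Schanuel.Schanuel.Theorems.RootDecomp1KRelLiouvilleCell
open Summit.Schanuel.Schanuel.Theorems.RootDecomp1KLogLogCell (LogLogLiouville logLogLiouville_of_logSqLiouville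
  logLogLiouville_of_logHyperLiouville logLogLiouville_of_hyperLiouville)

namespace Summit.Schanuel.Schanuel.Theorems.RootDecomp1KTwoBaseCell

open LiouvilleNumber
open scoped Nat

section Cells
open LiouvilleNumber
open scoped Nat

/-- `1 < ℓ₂` (Mathlib's `liouvilleNumber 2 = Σ_{i ≥ 0} 2^{-i!} = 1/2 + 1/2 + 1/4 + 1/64 + …`). -/
private theorem one_lt_liouvilleNumber_two : 1 < liouvilleNumber 2 := by
  have h := partialSum_add_remainder (by norm_num : (1 : ℝ) < 2) 1
  have hp : partialSum 2 1 = 1 := by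
    simp [partialSum, Finset.sum_range_succ]; norm_num
  have hr := remainder_pos (by norm_num : (1 : ℝ) < 2) 1
  linarith

/-! ### The members `z_W = (1, ℓ₂, ℓ₃)` and `z_W^π = (π, πℓ₂, πℓ₃)` -/

/-- The wall member `z_W := (1, ℓ₂, ℓ₃)`. -/
def zW : Fin 3 → ℂ := ![(1 : ℂ), ((liouvilleNumber 2 : ℝ) : ℂ), ((liouvilleNumber 3 : ℝ) : ℂ)]

/-- Its π-twin `z_W^π := (π, πℓ₂, πℓ₃)`. -/
def zWpi : Fin 3 → ℂ :=
  ![(Real.pi : ℂ), (Real.pi : ℂ) * ((liouvilleNumber 2 : ℝ) : ℂ), (Real.pi : ℂ) * ((liouvilleNumber 3 : ℝ) : ℂ)]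

/-- Literal read-out of `z_W = (1, ℓ₂, ℓ₃)`. -/
theorem zW_eq : zW = ![(1 : ℂ), ((liouvilleNumber 2 : ℝ) : ℂ), ((liouvilleNumber 3 : ℝ) : ℂ)] := rfl

/-- Literal read-out of `z_W^π = (π, πℓ₂, πℓ₃)`. -/
theorem zWpi_eq : zWpi = ![(Real.pi : ℂ), (Real.pi : ℂ) * ((liouvilleNumber 2 : ℝ) : ℂ),
    (Real.pi : ℂ) * ((liouvilleNumber 3 : ℝ) : ℂ)] := rfl

/-- An integer form in `z_W` is the real number `g₀ + g₁ ℓ₂ + g₂ ℓ₃`. -/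
theorem zW_form (g : Fin 3 → ℤ) :
    ∑ i, (g i : ℂ) * zW i = (((g 0 : ℝ) + g 1 * liouvilleNumber 2 + g 2 * liouvilleNumber 3 : ℝ) : ℂ) := by
  rw [Fin.sum_univ_three]
  simp only [zW, Matrix.cons_val_zero, Matrix.cons_val_one, Matrix.cons_val_two, Matrix.head_cons,
    Matrix.tail_cons]
  push_cast; ring

/-- An integer form in `z_W^π` is `π · (g₀ + g₁ ℓ₂ + g₂ ℓ₃)`. -/
theorem zWpi_form (g : Fin 3 → ℤ) :
    ∑ i, (g i : ℂ) * zWpi i =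
      (Real.pi : ℂ) * (((g 0 : ℝ) + g 1 * liouvilleNumber 2 + g 2 * liouvilleNumber 3 : ℝ) : ℂ) := by
  rw [Fin.sum_univ_three]
  simp only [zWpi, Matrix.cons_val_zero, Matrix.cons_val_one, Matrix.cons_val_two, Matrix.head_cons,
    Matrix.tail_cons]
  push_cast; ring

/-- The norm of an integer form in `z_W` is `|g₀ + g₁ ℓ₂ + g₂ ℓ₃|`. -/
theorem norm_zW_form (g : Fin 3 → ℤ) :
    ‖∑ i, (g i : ℂ) * zW i‖ = |(g 0 : ℝ) + g 1 * liouvilleNumber 2 + g 2 * liouvilleNumber 3| := by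
  rw [zW_form, Complex.norm_real, Real.norm_eq_abs]

/-- The norm of an integer form in `z_W^π` is `π · |g₀ + g₁ ℓ₂ + g₂ ℓ₃|`. -/
theorem norm_zWpi_form (g : Fin 3 → ℤ) :
    ‖∑ i, (g i : ℂ) * zWpi i‖ =
      Real.pi * |(g 0 : ℝ) + g 1 * liouvilleNumber 2 + g 2 * liouvilleNumber 3| := by
  rw [zWpi_form, norm_mul, Complex.norm_real, Complex.norm_real, Real.norm_eq_abs, Real.norm_eq_abs,
    abs_of_pos Real.pi_pos]

/-- No non-zero integer relation among `1, ℓ₂, ℓ₃`. -/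
theorem zW_form_ne_zero (g : Fin 3 → ℤ) (hg : g ≠ 0) :
    (g 0 : ℝ) + g 1 * liouvilleNumber 2 + g 2 * liouvilleNumber 3 ≠ 0 := by
  intro h0
  have := form_lower_bound_W g hg
  rw [h0, abs_zero] at this
  exact absurd this (not_le.mpr (Real.exp_pos _))

/-- From integer to rational relations (re-proof of the private Cell08 helper, attributed). -/
private theorem linearIndependent_of_int_forms' {z : Fin 3 → ℂ}
    (hz : ∀ g : Fin 3 → ℤ, g ≠ 0 → ∑ i, (g i : ℂ) * z i ≠ 0) : LinearIndependent ℚ z := by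
  rw [Fintype.linearIndependent_iff]
  intro g hg
  by_contra hne
  obtain ⟨i₀, hi₀⟩ := not_forall.mp hne
  have hg' : ((g 0 : ℚ) : ℂ) * z 0 + ((g 1 : ℚ) : ℂ) * z 1 + ((g 2 : ℚ) : ℂ) * z 2 = 0 := by
    simpa [Rat.smul_def, Fin.sum_univ_three] using hg
  have e0 : ((g 0 : ℚ) : ℂ) * ((g 0).den : ℂ) = ((g 0).num : ℂ) := by
    exact_mod_cast Rat.mul_den_eq_num (g 0)
  have e1 : ((g 1 : ℚ) : ℂ) * ((g 1).den : ℂ) = ((g 1).num : ℂ) := by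
    exact_mod_cast Rat.mul_den_eq_num (g 1)
  have e2 : ((g 2 : ℚ) : ℂ) * ((g 2).den : ℂ) = ((g 2).num : ℂ) := by
    exact_mod_cast Rat.mul_den_eq_num (g 2)
  set H : Fin 3 → ℤ := ![(g 0).num * ((g 1).den * (g 2).den : ℕ),
    (g 1).num * ((g 0).den * (g 2).den : ℕ), (g 2).num * ((g 0).den * (g 1).den : ℕ)] with hH
  have hd0 := (g 0).den_pos
  have hd1 := (g 1).den_pos
  have hd2 := (g 2).den_pos
  have hH0 : H ≠ 0 := by
    intro hzero
    have hnum : (g i₀).num ≠ 0 := Rat.num_ne_zero.mpr hi₀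
    have hc := congr_fun hzero i₀
    fin_cases i₀
    all_goals
      simp only [hH, Pi.zero_apply] at hc
      exact mul_ne_zero hnum (by positivity) hc
  have hrel : ∑ i, (H i : ℂ) * z i = 0 := by
    rw [Fin.sum_univ_three]
    simp only [hH, Matrix.cons_val_zero, Matrix.cons_val_one, Matrix.cons_val_two, Matrix.head_cons,
      Matrix.tail_cons]
    push_cast
    linear_combination (-(((g 1).den : ℂ) * ((g 2).den : ℂ) * z 0)) * e0
      - (((g 0).den : ℂ) * ((g 2).den : ℂ) * z 1) * e1
      - (((g 0).den : ℂ) * ((g 1).den : ℂ) * z 2) * e2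
      + (((g 0).den : ℂ) * ((g 1).den : ℂ) * ((g 2).den : ℂ)) * hg'
  exact hz H hH0 hrel

/-- **(i) `z_W` is ℚ-linearly independent** (hypothesis-free). -/
theorem linearIndependent_zW : LinearIndependent ℚ zW := by
  refine linearIndependent_of_int_forms' fun g hg hrel => ?_
  have h := zW_form g
  rw [hrel] at h
  exact zW_form_ne_zero g hg (by exact_mod_cast h.symm)

/-- **(i^π) `z_W^π` is ℚ-linearly independent** (hypothesis-free). -/
theorem linearIndependent_zWpi : LinearIndependent ℚ zWpi := by
  refine linearIndependent_of_int_forms' fun g hg hrel => ?_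
  have h := zWpi_form g
  rw [hrel] at h
  have hπ0 : (Real.pi : ℂ) ≠ 0 := by exact_mod_cast Real.pi_ne_zero
  have h' := (mul_eq_zero.mp h.symm).resolve_left hπ0
  exact zW_form_ne_zero g hg (by exact_mod_cast h')

/-- **(ii) `z_W` is Liouville to every polynomial order** (through its prefix `(1, ℓ₂)`; hypothesis-free). -/
theorem linLiouville_zW : LinLiouville zW := by
  have hℓ : Liouville (liouvilleNumber 2) := by
    simpa using liouville_liouvilleNumber (le_refl 2)
  refine linLiouville_of_prefix (k := 2) (n := 3) (by norm_num) ?_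
  have h2 : (fun i : Fin 2 => zW (Fin.castLE (show 2 ≤ 3 by norm_num) i)) =
      ![(1 : ℂ), ((liouvilleNumber 2 : ℝ) : ℂ) * 1] := by
    funext i; fin_cases i <;> simp [zW]
  rw [h2]
  exact linLiouville_of_liouville_ratio hℓ 1

/-- **(ii^π) `z_W^π` is Liouville to every polynomial order** (prefix `(π, πℓ₂)`; hypothesis-free). -/
theorem linLiouville_zWpi : LinLiouville zWpi := by
  have hℓ : Liouville (liouvilleNumber 2) := by
    simpa using liouville_liouvilleNumber (le_refl 2)
  refine linLiouville_of_prefix (k := 2) (n := 3) (by norm_num) ?_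
  have h2 : (fun i : Fin 2 => zWpi (Fin.castLE (show 2 ≤ 3 by norm_num) i)) =
      ![(Real.pi : ℂ), ((liouvilleNumber 2 : ℝ) : ℂ) * (Real.pi : ℂ)] := by
    funext i; fin_cases i <;> simp [zWpi, mul_comm]
  rw [h2]
  exact linLiouville_of_liouville_ratio hℓ (Real.pi : ℂ)

/-- **(iii) `z_W` has NO hyper-small integer forms** (the two-scale bound §6; hypothesis-free). -/
theorem not_hyperLinLiouville_zW : ¬ HyperLinLiouville zW := by
  intro hH
  obtain ⟨g, hg, hlt⟩ := hH 12
  rw [norm_zW_form] at hlt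
  have hlow := form_lower_bound_W g hg
  have hX : (1 : ℝ) ≤ 1 + ∑ i, (|g i| : ℝ) := by
    have : (0 : ℝ) ≤ ∑ i, (|g i| : ℝ) :=
      Finset.sum_nonneg fun i _ => by exact_mod_cast abs_nonneg (g i)
    linarith
  have hmono : (1 + ∑ i, (|g i| : ℝ)) ^ 11 ≤ (1 + ∑ i, (|g i| : ℝ)) ^ 12 :=
    pow_le_pow_right₀ hX (by norm_num)
  have := Real.exp_le_exp.mpr (neg_le_neg hmono)
  linarith

/-- **(iii^π) `z_W^π` has NO hyper-small integer forms** (`|π·form| ≥ |form|`; hypothesis-free). -/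
theorem not_hyperLinLiouville_zWpi : ¬ HyperLinLiouville zWpi := by
  intro hH
  obtain ⟨g, hg, hlt⟩ := hH 12
  rw [norm_zWpi_form] at hlt
  have hlow := form_lower_bound_W g hg
  have hX : (1 : ℝ) ≤ 1 + ∑ i, (|g i| : ℝ) := by
    have : (0 : ℝ) ≤ ∑ i, (|g i| : ℝ) :=
      Finset.sum_nonneg fun i _ => by exact_mod_cast abs_nonneg (g i)
    linarith
  have hmono : (1 + ∑ i, (|g i| : ℝ)) ^ 11 ≤ (1 + ∑ i, (|g i| : ℝ)) ^ 12 :=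
    pow_le_pow_right₀ hX (by norm_num)
  have := Real.exp_le_exp.mpr (neg_le_neg hmono)
  have hπ : (1 : ℝ) ≤ Real.pi := by have := Real.pi_gt_three; linarith
  have habs := abs_nonneg ((g 0 : ℝ) + g 1 * liouvilleNumber 2 + g 2 * liouvilleNumber 3)
  nlinarith

/-- **(iv) Schanuel's bound AT `z_W`** (mod `hNW` only). -/
theorem sb_zW (hNW : NWMeasure) : SB 3 zW := sb_twoBaseCell hNW

/-- **(iv^π) Schanuel's bound AT `z_W^π` — HYPOTHESIS-FREE.** -/
theorem sb_zWpi : SB 3 zWpi := sb_twoBaseCell_pi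

/-- **`z_W` lies in the scope of item 33364** — all three hypotheses, hypothesis-free. -/
theorem zW_in_scope_33364 :
    LinearIndependent ℚ zW ∧
    (∀ ω : ℕ, ∃ h : Fin 3 → ℤ, h ≠ 0 ∧ ‖∑ i, (h i : ℂ) * zW i‖ < 1 / (1 + ∑ i, (|h i| : ℝ)) ^ ω) ∧
    (¬ ∀ m : ℕ, ∃ h : Fin 3 → ℤ, h ≠ 0 ∧
      ‖∑ i, (h i : ℂ) * zW i‖ < Real.exp (-((1 + ∑ i, (|h i| : ℝ)) ^ m))) :=
  ⟨linearIndependent_zW, linLiouville_zW, not_hyperLinLiouville_zW⟩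

/-- **`z_W^π` lies in the scope of item 33364** — all three hypotheses, hypothesis-free. -/
theorem zWpi_in_scope_33364 :
    LinearIndependent ℚ zWpi ∧
    (∀ ω : ℕ, ∃ h : Fin 3 → ℤ, h ≠ 0 ∧ ‖∑ i, (h i : ℂ) * zWpi i‖ < 1 / (1 + ∑ i, (|h i| : ℝ)) ^ ω) ∧
    (¬ ∀ m : ℕ, ∃ h : Fin 3 → ℤ, h ≠ 0 ∧
      ‖∑ i, (h i : ℂ) * zWpi i‖ < Real.exp (-((1 + ∑ i, (|h i| : ℝ)) ^ m))) :=
  ⟨linearIndependent_zWpi, linLiouville_zWpi, not_hyperLinLiouville_zWpi⟩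

/-- **ITEM 33364 DECIDED AT `z_W`** (mod `hNW`): scope (i)–(iii) hypothesis-free AND the conclusion. -/
theorem finiteOrderLiouvilleSchanuel_at_zW (hNW : NWMeasure) :
    LinearIndependent ℚ zW ∧ LinLiouville zW ∧ ¬ HyperLinLiouville zW ∧ SB 3 zW :=
  ⟨linearIndependent_zW, linLiouville_zW, not_hyperLinLiouville_zW, sb_zW hNW⟩

/-- **ITEM 33364 DECIDED AT `z_W^π` — HYPOTHESIS-FREE**: scope (i)–(iii) AND the conclusion. -/
theorem finiteOrderLiouvilleSchanuel_at_zWpi :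
    LinearIndependent ℚ zWpi ∧ LinLiouville zWpi ∧ ¬ HyperLinLiouville zWpi ∧ SB 3 zWpi :=
  ⟨linearIndependent_zWpi, linLiouville_zWpi, not_hyperLinLiouville_zWpi, sb_zWpi⟩

/-- **`ℓ₃` is BELOW every previously decided class** (hypothesis-free): not log-log-Liouville (g35's class, tree
`RootDecomp1KLogLogCell.LogLogLiouville`), hence not log-square (lens 6 g14), not log-hyper (g34), not hyper-Liouville
(the route's class) — by the tree ladder lemmas. Same for `ℓ₂`. -/
theorem zW_coordinates_below_previous_classes :
    ¬ LogLogLiouville (liouvilleNumber 3) ∧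
    ¬ Summit.Schanuel.Schanuel.Theorems.RootDecomp1KGeneric.LogSqLiouville (liouvilleNumber 3) ∧
    ¬ Summit.Schanuel.Schanuel.Theorems.RootDecomp1KRelLiouvilleCell.LogHyperLiouville (liouvilleNumber 3) ∧
    ¬ Summit.Schanuel.Schanuel.Theorems.RootDecomp1KHyper.HyperCell.HyperLiouville (liouvilleNumber 3) ∧
    ¬ LogLogLiouville (liouvilleNumber 2) := by
  have h3 : ¬ LogLogLiouville (liouvilleNumber 3) := by
    simpa using not_logLogLiouville_liouvilleNumber (by norm_num : 2 ≤ 3)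
  have h2 : ¬ LogLogLiouville (liouvilleNumber 2) := by
    simpa using not_logLogLiouville_liouvilleNumber (le_refl 2)
  exact ⟨h3, fun h => h3 (logLogLiouville_of_logSqLiouville h),
    fun h => h3 (logLogLiouville_of_logHyperLiouville h), fun h => h3 (logLogLiouville_of_hyperLiouville h), h2⟩

/-- Range bookkeeping: if `Set.range z_W = Set.range (1, ℓ₂, ρ)` then `ρ = ℓ₃`. -/
theorem eq_of_range_zW_eq {ρ : ℝ}
    (h : Set.range zW = Set.range ![(1 : ℂ), ((liouvilleNumber 2 : ℝ) : ℂ), (ρ : ℂ)]) :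
    ρ = liouvilleNumber 3 := by
  have hlt := liouvilleNumber_three_lt_one
  have hgt := one_lt_liouvilleNumber_two
  have hmem : zW 2 ∈ Set.range ![(1 : ℂ), ((liouvilleNumber 2 : ℝ) : ℂ), (ρ : ℂ)] := h ▸ ⟨2, rfl⟩
  obtain ⟨j, hj⟩ := hmem
  have e2 : zW 2 = ((liouvilleNumber 3 : ℝ) : ℂ) := rfl
  rw [e2] at hj
  fin_cases j
  · simp only [Fin.zero_eta, Matrix.cons_val_zero] at hj
    have : (1 : ℝ) = liouvilleNumber 3 := by exact_mod_cast hj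
    linarith
  · simp only [Fin.mk_one, Matrix.cons_val_one, Matrix.cons_val_zero] at hj
    have : liouvilleNumber 2 = liouvilleNumber 3 := by exact_mod_cast hj
    linarith
  · simp only [Fin.reduceFinMk, Matrix.cons_val_two, Matrix.tail_cons, Matrix.head_cons] at hj
    exact_mod_cast hj

/-- Range bookkeeping, π-twin: if `Set.range z_W^π = Set.range (π, πℓ₂, πρ)` then `ρ = ℓ₃`. -/
theorem eq_of_range_zWpi_eq {ρ : ℝ}
    (h : Set.range zWpi = Set.range ![(Real.pi : ℂ), (Real.pi : ℂ) * ((liouvilleNumber 2 : ℝ) : ℂ),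
      (Real.pi : ℂ) * (ρ : ℂ)]) :
    ρ = liouvilleNumber 3 := by
  have hlt := liouvilleNumber_three_lt_one
  have hgt := one_lt_liouvilleNumber_two
  have hπ0 : (Real.pi : ℂ) ≠ 0 := by exact_mod_cast Real.pi_ne_zero
  have hmem : zWpi 2 ∈ Set.range ![(Real.pi : ℂ), (Real.pi : ℂ) * ((liouvilleNumber 2 : ℝ) : ℂ),
      (Real.pi : ℂ) * (ρ : ℂ)] := h ▸ ⟨2, rfl⟩
  obtain ⟨j, hj⟩ := hmem
  have e2 : zWpi 2 = (Real.pi : ℂ) * ((liouvilleNumber 3 : ℝ) : ℂ) := rfl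
  rw [e2] at hj
  fin_cases j
  · simp only [Fin.zero_eta, Matrix.cons_val_zero] at hj
    have h1 : (Real.pi : ℂ) * 1 = (Real.pi : ℂ) * ((liouvilleNumber 3 : ℝ) : ℂ) := by rw [mul_one]; exact hj
    have h2 := mul_left_cancel₀ hπ0 h1
    have : (1 : ℝ) = liouvilleNumber 3 := by exact_mod_cast h2
    linarith
  · simp only [Fin.mk_one, Matrix.cons_val_one, Matrix.cons_val_zero] at hj
    have h2 := mul_left_cancel₀ hπ0 hj
    have : liouvilleNumber 2 = liouvilleNumber 3 := by exact_mod_cast h2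
    linarith
  · simp only [Fin.reduceFinMk, Matrix.cons_val_two, Matrix.tail_cons, Matrix.head_cons] at hj
    have h2 := mul_left_cancel₀ hπ0 hj
    exact_mod_cast h2

/-- **`z_W` and `z_W^π` lie on NO g35 log-log cell** (and a fortiori on no g34 log-hyper cell, no hyper-Liouville cell):
the cells `Set.range z = Set.range (1, ℓ₂, ρ)` / `(π, πℓ₂, πρ)` with `ρ` log-log-Liouville miss them. Hypothesis-free. -/
theorem zW_outside_logLogCells :
    (¬ ∃ ρ : ℝ, LogLogLiouville ρ ∧
        Set.range zW = Set.range ![(1 : ℂ), ((liouvilleNumber 2 : ℝ) : ℂ), (ρ : ℂ)]) ∧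
    (¬ ∃ ρ : ℝ, LogLogLiouville ρ ∧
        Set.range zWpi = Set.range ![(Real.pi : ℂ), (Real.pi : ℂ) * ((liouvilleNumber 2 : ℝ) : ℂ),
          (Real.pi : ℂ) * (ρ : ℂ)]) := by
  have h3 := zW_coordinates_below_previous_classes.1
  refine ⟨?_, ?_⟩
  · rintro ⟨ρ, hρ, hr⟩
    rw [eq_of_range_zW_eq hr] at hρ
    exact h3 hρ
  · rintro ⟨ρ, hρ, hr⟩
    rw [eq_of_range_zWpi_eq hr] at hρ
    exact h3 hρ

end Cells

end Summit.Schanuel.Schanuel.Theorems.RootDecomp1KTwoBaseCell
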